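import Summits.QuantumAdvantage.QuantumAdvantage.Theorems.CubicForrelationNearExactIsExactAmmCeilingZ
import Summits.QuantumAdvantage.QuantumAdvantage.Theorems.CubicForrelationNearExactIsExactAmmCeilingV
import Summits.QuantumAdvantage.QuantumAdvantage.Theorems.CubicForrelationNearExactIsExactAmmCeilingM
import Summits.QuantumAdvantage.QuantumAdvantage.Theorems.CubicStability.Negative.P4Facts

/-!
# Crux `CubicForrelation.NearExactIsExact` (stmt-QuantumAdvantage-14043) — the ALMOST-MAIORANA–McFARLAND CEILING
(registered stub `stub_ammCeiling` of the line `direct-sum-amplification`, lead c3)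

THEOREM.  Let `f` be cubic on `a + (a+2)` bits, `φ : 𝔽₂^{a+2} → 𝔽₂^a` coordinatewise quadratic, `h` cubic and `g` of
the almost-MM sign form `(−1)^{g(y₁‖y₂)} = (−1)^{y₁·φ(y₂)} (−1)^{h(y₂)}` (so `g` is affine on every coset of the
`a`-dimensional `y₁`-block: relative M-subspace of dimension `n/2 − 1`).  Then
`Φ(f,g) = 1`, or `Φ(f,g) ≤ 1 − 2⁻¹⁰`, or `g` has a genuine M-subspace (dimension `a + 1 = n/2`).
This extends the Maiorana–McFarland ceiling (landed, `31/32`) one level up the relative-MM filtration; the class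
contains cubic bent functions outside `MM#` (Kudin–Pasalic–Polujan–Zhang 2025).

PROOF (parts Q, X, Y, W, Z, V, M of this directory; here only the assembly).  With `K = 2^{a+2}` and
`T(y) = (−1)^{h y} W_{c_{φ y}}(y)`, AW gives `Φ = 2^{−(2a+3)} Σ_y T(y) = 2^{−(2a+3)} Σ_{x₁} Γ(x₁)`.  If `Φ > 1 − 2⁻¹⁰`
the accounting AA bounds the bad fibres by `2^{a+4}(1 − Φ) < 2^a/64`; a good fibre exists, so all slices are
quadratic (X); the first wall gives Plücker everywhere (X), the second wall puts every corner in its fibre (W); the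
total bound `Σ Γ ≤ 2K·2^a − K|Z|` (Z) gives `|Z| ≤ 2^{a+1}(1 − Φ) < 2^{a+1}/1024`.  If `Z ≠ ∅`, the rank-two pencil
RP yields either a common row vector `w` — then `φ` is `w`-periodic (Z) and `y₁`-block `⊕ ⟨0‖w⟩` is an
M-subspace (M) — or `2^a ≤ 8|Z|`, impossible.  If `Z = ∅`, every fibre is a corner flat and
`Γ(x₁) = (K/2) Σ_{στ} (−1)^{m_{στ}(x₁)}` (V); one mismatch bit propagates to `≥ 2^a/128` fibres (degree-7
indicator, V), forcing `1 − Φ ≥ 2⁻⁸`, impossible; so there is no mismatch, every `Γ = 2K` and `Φ = 1`.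

References: S. Kudin, E. Pasalic, A. Polujan, F. Zhang, *Almost Maiorana-McFarland bent functions*, arXiv:2508.14265
(IEEE TIT 2025); C. Carlet, *Boolean Functions for Cryptography and Coding Theory* (CUP 2021), §5.1, §6.1;
J. F. Dillon, PhD thesis (1974) (M-subspaces).
-/

set_option linter.dupNamespace false -- D-0017: single-problem summit ⇒ `QuantumAdvantage.QuantumAdvantage` by design

noncomputable section

namespace Summit.QuantumAdvantage.QuantumAdvantage.Theorems.CubicForrelation.NearExactIsExact

open Finset
open Literature.Computability.QuantumComplexity
open Literature.Computability.QuantumComplexity.BuzetChailloux (bxor zeroVec signOf_sq bxor_zeroVec zeroVec_bxor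
  bxor_comm bxor_self bxor_bxor_cancel_left twist_zeroVec_right twist_bxor_right sum_twist_left bxor_eq_zeroVec_iff)
open Literature.Computability.QuantumComplexity.DerivativeWalsh (W signOf_not)

/-- A sum of four signs is at most `4`, and at most `2` if one of them is `-1`. [folklore] -/
theorem ac_sum_four_signs (m : Bool × Bool → Bool) :
    (∑ st : Bool × Bool, signOf (m st)) ≤ 4 ∧ (∀ st₀, m st₀ = true → (∑ st : Bool × Bool, signOf (m st)) ≤ 2) ∧
      ((∀ st, m st = false) → (∑ st : Bool × Bool, signOf (m st)) = 4) := by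
  refine ⟨?_, fun st₀ hst => ?_, fun hall => ?_⟩
  · calc (∑ st : Bool × Bool, signOf (m st)) ≤ ∑ _st : Bool × Bool, (1 : ℝ) := sum_le_sum fun st _ => Summit.QuantumAdvantage.QuantumAdvantage.Theorems.CubicStability.Negative.P4.signOf_le_one _
      _ = 4 := by simp
  · rw [← add_sum_erase univ (fun st => signOf (m st)) (mem_univ st₀), hst]
    have h3 : (∑ st ∈ univ.erase st₀, signOf (m st)) ≤ 3 := by
      calc (∑ st ∈ univ.erase st₀, signOf (m st)) ≤ ∑ _st ∈ univ.erase st₀, (1 : ℝ) :=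
            sum_le_sum fun st _ => Summit.QuantumAdvantage.QuantumAdvantage.Theorems.CubicStability.Negative.P4.signOf_le_one _
        _ = 3 := by
            rw [sum_const, card_erase_of_mem (mem_univ _), card_univ, Fintype.card_prod, Fintype.card_bool]
            norm_num
    norm_num [signOf] at h3 ⊢
    linarith
  · simp only [hall]
    simp [signOf]

/-- **The almost-Maiorana–McFarland ceiling** (registered stub `stub_ammCeiling`; see the module docstring). -/
theorem stub_ammCeiling :
    (∀ (n d : ℕ) (e : (Fin n → Bool) → Bool) (t : Fin n → Bool), IsDegLeFun (d + 1) e →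
      IsDegLeFun d (fun x => e x ^^ e (bxor x t))) →
    (∀ (m d : ℕ) (e : (Fin m → Bool) → Bool), IsDegLeFun d e → (∃ x, e x = true) →
      2 ^ m ≤ 2 ^ d * (univ.filter fun x => e x = true).card) →
    (∀ (a : ℕ) (f g : (Fin (a + (a + 2)) → Bool) → Bool) (φ : (Fin (a + 2) → Bool) → (Fin a → Bool))
      (h : (Fin (a + 2) → Bool) → Bool),
      (∀ (y₁ : Fin a → Bool) (y₂ : Fin (a + 2) → Bool),
        signOf (g (Fin.append y₁ y₂)) = twist y₁ (φ y₂) * signOf (h y₂)) →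
      forrelation f g = ((2 : ℝ) ^ (2 * a + 3))⁻¹ *
        ∑ y₂ : Fin (a + 2) → Bool, signOf (h y₂) *
          ∑ x₂ : Fin (a + 2) → Bool, signOf (f (Fin.append (φ y₂) x₂)) * twist x₂ y₂) →
    (∀ (k : ℕ) (c : (Fin k → Bool) → Bool) (y₁ y₂ y₃ y₄ : Fin k → Bool), IsDegLeFun 3 c →
      y₁ ≠ y₂ → y₁ ≠ y₃ → y₁ ≠ y₄ → y₂ ≠ y₃ → y₂ ≠ y₄ → y₃ ≠ y₄ →
      (15 / 8 : ℝ) * (2 : ℝ) ^ k < |W (fun x => signOf (c x)) y₁| + |W (fun x => signOf (c x)) y₂| +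
        |W (fun x => signOf (c x)) y₃| + |W (fun x => signOf (c x)) y₄| →
      ∃ (s u v : Fin k → Bool) (e : Bool), u ≠ zeroVec ∧ v ≠ zeroVec ∧ u ≠ v ∧
        (∀ x, signOf (c x) = signOf e * twist s x * ((1 + twist u x + twist v x - twist u x * twist v x) / 2)) ∧
        ({y₁, y₂, y₃, y₄} : Finset (Fin k → Bool)) = {s, bxor s u, bxor s v, bxor s (bxor u v)}) →
    (∀ (a k : ℕ) (M : (Fin a → Bool) → Fin k → Fin k → Bool),
      (∀ x i, M x i i = false) → (∀ x i j, M x i j = M x j i) →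
      (∀ x x' i j, M (bxor x x') i j = (M x i j ^^ M x' i j ^^ M zeroVec i j)) →
      (∀ x i j i' j', ((M x i j && M x i' j') ^^ (M x i i' && M x j j') ^^ (M x i j' && M x j i')) = false) →
      (∃ z, ∀ i j, M z i j = false) →
      (∃ w : Fin k → Bool, w ≠ zeroVec ∧ ∀ x, (∃ i j, M x i j = true) →
          ∃ s : Fin k → Bool, ∀ l, (if w l then (1 : ZMod 2) else 0) =
            ∑ i, (if s i then (1 : ZMod 2) else 0) * (if M x i l then (1 : ZMod 2) else 0)) ∨
      2 ^ a ≤ 8 * (univ.filter fun z : Fin a → Bool => ∀ i j, M z i j = false).card) →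
    ((∀ (k : ℕ) (c : (Fin k → Bool) → Bool) (y₁ y₂ y₃ y₄ : Fin k → Bool), IsDegLeFun 3 c →
      y₁ ≠ y₂ → y₁ ≠ y₃ → y₁ ≠ y₄ → y₂ ≠ y₃ → y₂ ≠ y₄ → y₃ ≠ y₄ →
      (15 / 8 : ℝ) * (2 : ℝ) ^ k < |W (fun x => signOf (c x)) y₁| + |W (fun x => signOf (c x)) y₂| +
        |W (fun x => signOf (c x)) y₃| + |W (fun x => signOf (c x)) y₄| →
      ∃ (s u v : Fin k → Bool) (e : Bool), u ≠ zeroVec ∧ v ≠ zeroVec ∧ u ≠ v ∧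
        (∀ x, signOf (c x) = signOf e * twist s x * ((1 + twist u x + twist v x - twist u x * twist v x) / 2)) ∧
        ({y₁, y₂, y₃, y₄} : Finset (Fin k → Bool)) = {s, bxor s u, bxor s v, bxor s (bxor u v)}) →
    ∀ (a : ℕ) (f : (Fin (a + (a + 2)) → Bool) → Bool) (φ : (Fin (a + 2) → Bool) → (Fin a → Bool))
      (h : (Fin (a + 2) → Bool) → Bool), IsDegLeFun 3 f →
      ((univ.filter fun x₁ : Fin a → Bool => ¬ ((univ.filter fun y : Fin (a + 2) → Bool => φ y = x₁).card = 4 ∧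
          ∀ y : Fin (a + 2) → Bool, φ y = x₁ →
            signOf (h y) * W (fun x₂ => signOf (f (Fin.append x₁ x₂))) y = (2 : ℝ) ^ (a + 2) / 2)).card : ℝ) ≤
        (2 : ℝ) ^ (a + 4) * (1 - ((2 : ℝ) ^ (2 * a + 3))⁻¹ *
          ∑ y₂ : Fin (a + 2) → Bool, signOf (h y₂) *
            ∑ x₂ : Fin (a + 2) → Bool, signOf (f (Fin.append (φ y₂) x₂)) * twist x₂ y₂)) →
    ∀ (a : ℕ) (f g : (Fin (a + (a + 2)) → Bool) → Bool) (φ : (Fin (a + 2) → Bool) → (Fin a → Bool))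
      (h : (Fin (a + 2) → Bool) → Bool),
      IsDegLeFun 3 f → (∀ i : Fin a, IsDegLeFun 2 (fun y => φ y i)) → IsDegLeFun 3 h →
      (∀ (y₁ : Fin a → Bool) (y₂ : Fin (a + 2) → Bool),
        signOf (g (Fin.append y₁ y₂)) = twist y₁ (φ y₂) * signOf (h y₂)) →
      forrelation f g = 1 ∨ forrelation f g ≤ 1 - 1 / 1024 ∨
        (∃ V : Finset (Fin (a + (a + 2)) → Bool), zeroVec ∈ V ∧ (∀ x ∈ V, ∀ y ∈ V, bxor x y ∈ V) ∧
          V.card * V.card = 2 ^ (a + (a + 2)) ∧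
          ∀ u ∈ V, ∀ v ∈ V, ∀ y, (g y ^^ g (bxor y u) ^^ g (bxor y v) ^^ g (bxor y (bxor u v))) = false) := by
  intro hD hR hAW hFP hRP hAA a f g φ h hf hφ hh hsign
  classical
  -- the window: otherwise we are done
  by_cases hΦ : forrelation f g ≤ 1 - 1 / 1024
  · exact Or.inr (Or.inl hΦ)
  push Not at hΦ
  obtain ⟨l, hld, hl⟩ := fc_linForm_exists (a + 2)
  -- Φ as a fibre sum (AW) and the bad-fibre count (AA)
  have hΦsum : forrelation f g = ((2 : ℝ) ^ (2 * a + 3))⁻¹ *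
      ∑ y : Fin (a + 2) → Bool, signOf (h y) * W (fun x₂ => signOf (f (Fin.append (φ y) x₂))) y :=
    hAW a f g φ h hsign
  set BAD := univ.filter (fun x₁ : Fin a → Bool => ¬ ((univ.filter fun y : Fin (a + 2) → Bool => φ y = x₁).card = 4 ∧
    ∀ y : Fin (a + 2) → Bool, φ y = x₁ →
      signOf (h y) * W (fun x₂ => signOf (f (Fin.append x₁ x₂))) y = (2 : ℝ) ^ (a + 2) / 2)) with hBAD
  have hbadR : (BAD.card : ℝ) ≤ (2 : ℝ) ^ (a + 4) * (1 - forrelation f g) := by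
    rw [hΦsum]; exact hAA hFP a f φ h hf
  have hbad64 : BAD.card * 64 < 2 ^ a := by
    have h1 : (BAD.card : ℝ) * 64 < (2 : ℝ) ^ a := by
      have e : (2 : ℝ) ^ (a + 4) = (2 : ℝ) ^ a * 16 := by rw [pow_add]; norm_num
      nlinarith [hbadR, hΦ, pow_pos (show (0 : ℝ) < 2 by norm_num) a]
    exact_mod_cast h1
  have hbad4 : BAD.card * 4 < 2 ^ a := by omega
  have hbad32 : BAD.card * 32 < 2 ^ a := by omega
  -- a good fibre exists, hence every slice is quadratic
  have hgoodex : ∃ x₀, x₀ ∉ BAD := by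
    by_contra hall
    push Not at hall
    have : BAD = univ := eq_univ_of_forall hall
    rw [this, card_univ, Fintype.card_fun, Fintype.card_bool, Fintype.card_fin] at hbad64
    have : 1 ≤ 2 ^ a := Nat.one_le_two_pow
    omega
  obtain ⟨x₀, hx₀⟩ := hgoodex
  have hG0 : (univ.filter fun y : Fin (a + 2) → Bool => φ y = x₀).card = 4 ∧
      ∀ y : Fin (a + 2) → Bool, φ y = x₀ →
        signOf (h y) * W (fun x₂ => signOf (f (Fin.append x₀ x₂))) y = (2 : ℝ) ^ (a + 2) / 2 := by
    by_contra hn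
    exact hx₀ (mem_filter.2 ⟨mem_univ _, hn⟩)
  obtain ⟨s0, u0, v0, e0, -, -, -, hc0, -⟩ := acx_good_structure hFP l hl hf φ h x₀ hG0.1 hG0.2
  have hq : ∀ x₁, IsDegLeFun 2 (fun x₂ : Fin (a + 2) → Bool => f (Fin.append x₁ x₂)) :=
    acx_slice_quadratic hf (acx_deg_aligned l hld hc0)
  -- polar entries; first wall (Plücker everywhere); second wall (corners in fibres)
  set B : (Fin a → Bool) → Fin (a + 2) → Fin (a + 2) → Bool := fun x₁ i j =>
    f (Fin.append x₁ zeroVec) ^^ f (Fin.append x₁ (Pi.single i true)) ^^ f (Fin.append x₁ (Pi.single j true)) ^^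
      f (Fin.append x₁ (bxor (Pi.single i true) (Pi.single j true))) with hBdef
  have hB : ∀ x₁ i j, B x₁ i j = (f (Fin.append x₁ zeroVec) ^^ f (Fin.append x₁ (Pi.single i true)) ^^
      f (Fin.append x₁ (Pi.single j true)) ^^ f (Fin.append x₁ (bxor (Pi.single i true) (Pi.single j true)))) :=
    fun _ _ _ => rfl
  have hPl : ∀ x₁ i j i' j', ((B x₁ i j && B x₁ i' j') ^^ (B x₁ i i' && B x₁ j j') ^^ (B x₁ i j' && B x₁ j i')) = false :=
    fun x₁ i j i' j' => acx_pluecker_all hFP hf φ h hbad4 x₁ i j i' j'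
  set d : (Fin a → Bool) → Fin (a + 2) → Bool := fun x₁ j =>
    f (Fin.append x₁ (Pi.single j true)) ^^ f (Fin.append x₁ zeroVec) with hddef
  have hd : ∀ x₁ j, d x₁ j = (f (Fin.append x₁ (Pi.single j true)) ^^ f (Fin.append x₁ zeroVec)) := fun _ _ => rfl
  have hcm := acy_corner_mem hFP l hl hf φ hφ h B hB d hd hbad32 hPl hq
  -- the total fibre sum and the smallness of Z
  have hdec := acz_sum_fibrewise f φ h
  have htot := acz_gamma_total_le l hl φ h B hB hPl hq
  set Z := univ.filter (fun x₁ : Fin a → Bool => ∀ i j, B x₁ i j = false) with hZdef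
  have hpos : (0 : ℝ) < (2 : ℝ) ^ (2 * a + 3) := by positivity
  have hsumΦ : ∑ y : Fin (a + 2) → Bool, signOf (h y) * W (fun x₂ => signOf (f (Fin.append (φ y) x₂))) y =
      (2 : ℝ) ^ (2 * a + 3) * forrelation f g := by
    rw [hΦsum, ← mul_assoc, mul_inv_cancel₀ hpos.ne', one_mul]
  have e223 : 2 * (2 : ℝ) ^ (a + 2) * (2 : ℝ) ^ a = (2 : ℝ) ^ (2 * a + 3) := by
    rw [← pow_succ', ← pow_add]; ring_nf
  have hZR : (2 : ℝ) ^ (a + 2) * Z.card ≤ (2 : ℝ) ^ (2 * a + 3) * (1 - forrelation f g) := by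
    have := htot
    rw [← hdec, hsumΦ] at this
    linarith
  have e2a : (2 : ℝ) ^ (2 * a + 3) = (2 : ℝ) ^ (a + 2) * (2 : ℝ) ^ (a + 1) := by rw [← pow_add]; ring_nf
  have hZsmall : (Z.card : ℝ) * 1024 < (2 : ℝ) ^ (a + 1) := by
    have hKpos : (0 : ℝ) < (2 : ℝ) ^ (a + 2) := by positivity
    have : (2 : ℝ) ^ (a + 2) * Z.card * 1024 < (2 : ℝ) ^ (a + 2) * (2 : ℝ) ^ (a + 1) := by nlinarith
    nlinarith
  have hdiag : ∀ x i, B x i i = false := fun x i => by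
    show (f (Fin.append x zeroVec) ^^ f (Fin.append x (Pi.single i true)) ^^ f (Fin.append x (Pi.single i true)) ^^
      f (Fin.append x (bxor (Pi.single i true) (Pi.single i true)))) = false
    rw [bxor_self]; cases f (Fin.append x zeroVec) <;> cases f (Fin.append x (Pi.single i true)) <;> decide
  have hsymm : ∀ x i j, B x i j = B x j i := fun x i j => by
    show (f (Fin.append x zeroVec) ^^ f (Fin.append x (Pi.single i true)) ^^ f (Fin.append x (Pi.single j true)) ^^
      f (Fin.append x (bxor (Pi.single i true) (Pi.single j true)))) =
      (f (Fin.append x zeroVec) ^^ f (Fin.append x (Pi.single j true)) ^^ f (Fin.append x (Pi.single i true)) ^^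
      f (Fin.append x (bxor (Pi.single j true) (Pi.single i true))))
    rw [bxor_comm (Pi.single i true)]
    cases f (Fin.append x zeroVec) <;> cases f (Fin.append x (Pi.single i true)) <;> cases f (Fin.append x (Pi.single j true)) <;>
      cases f (Fin.append x (bxor (Pi.single j true) (Pi.single i true))) <;> decide
  by_cases hZne : ∃ z, ∀ i j, B z i j = false
  · -- Z ≠ ∅ : the rank-two pencil
    have hBdeg : ∀ i j, IsDegLeFun 1 (fun x => B x i j) := fun i j => acx_deg_polar hf _ _
    have haff : ∀ x x' i j, B (bxor x x') i j = (B x i j ^^ B x' i j ^^ B zeroVec i j) :=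
      fun x x' i j => acq_affine_of_deg_one (hBdeg i j) x x'
    rcases hRP a (a + 2) B hdiag hsymm haff hPl hZne with ⟨w, hw0, hw⟩ | hb
    · -- type (a): φ is w-periodic, and y₁-block ⊕ ⟨0‖w⟩ is an M-subspace
      have hZ2 : Z.card * 2 < 2 ^ a := by
        have e : (2 : ℝ) ^ (a + 1) = 2 * (2 : ℝ) ^ a := by rw [pow_succ]; ring
        have h1 : (Z.card : ℝ) * 2 < (2 : ℝ) ^ a := by nlinarith [pow_pos (show (0 : ℝ) < 2 by norm_num) a]
        exact_mod_cast h1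
      have hper := acz_periodic φ hφ B hB d hPl hcm w hw hZ2
      exact Or.inr (Or.inr (acz_msubspace_of_periodic a g φ h hsign w hw0 hper))
    · -- type (b): |Z| ≥ 2^a / 8 — impossible
      exfalso
      have h1 : ((2 : ℕ) ^ a : ℝ) ≤ 8 * (Z.card : ℝ) := by exact_mod_cast hb
      have e : (2 : ℝ) ^ (a + 1) = 2 * (2 : ℝ) ^ a := by rw [pow_succ]; ring
      push_cast at h1
      nlinarith [pow_pos (show (0 : ℝ) < 2 by norm_num) a]
  · -- Z = ∅ : fibres are corner flats
    push Not at hZne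
    have hZ0 : ∀ x₁, ∃ p q, B x₁ p q = true := by
      intro x₁
      obtain ⟨p, q, hpq⟩ := hZne x₁
      exact ⟨p, q, by revert hpq; cases B x₁ p q <;> simp⟩
    have hfib : ∀ x₁ (p q : Fin (a + 2)), B x₁ p q = true →
        (univ.filter fun y : Fin (a + 2) → Bool => φ y = x₁) =
          univ.image (fun st : Bool × Bool => fun j =>
            (d x₁ j ^^ (B x₁ p j && B x₁ q j)) ^^ (st.1 && B x₁ p j) ^^ (st.2 && B x₁ q j)) :=
      fun x₁ p q hpq => acv_fibre_eq_corners φ B d hB hcm hZ0 x₁ hpq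
    have hΓ : ∀ x₁ (p q : Fin (a + 2)), B x₁ p q = true →
        ∑ y ∈ univ.filter (fun y : Fin (a + 2) → Bool => φ y = x₁),
            signOf (h y) * W (fun x₂ => signOf (f (Fin.append x₁ x₂))) y =
          (2 : ℝ) ^ (a + 2) / 2 * ∑ st : Bool × Bool,
            signOf (h (fun j => (d x₁ j ^^ (B x₁ p j && B x₁ q j)) ^^ (st.1 && B x₁ p j) ^^ (st.2 && B x₁ q j)) ^^
              f (Fin.append x₁ zeroVec) ^^ (st.1 && st.2)) :=
      fun x₁ p q hpq => acv_gamma_eq φ h B d l hl hB hd hPl hq x₁ hpq (hfib x₁ p q hpq)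
    choose P Q hPQ using hZ0
    by_cases hmis : ∃ (x₁ : Fin a → Bool) (st : Bool × Bool),
        (h (fun j => (d x₁ j ^^ (B x₁ (P x₁) j && B x₁ (Q x₁) j)) ^^ (st.1 && B x₁ (P x₁) j) ^^ (st.2 && B x₁ (Q x₁) j)) ^^
          f (Fin.append x₁ zeroVec) ^^ (st.1 && st.2)) = true
    · -- a mismatch propagates to ≥ 2^a/128 fibres, each losing ≥ K: contradiction with Φ > 1 − 2⁻¹⁰
      exfalso
      obtain ⟨xs, ⟨σ, τ⟩, hm⟩ := hmis
      set p := P xs with hp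
      set q := Q xs with hq'
      have hμ0 : (B xs p q && (h (fun j => (d xs j ^^ (B xs p j && B xs q j)) ^^ (σ && B xs p j) ^^ (τ && B xs q j)) ^^
          f (Fin.append xs zeroVec) ^^ (σ && τ))) = true := by
        rw [hPQ xs]; exact hm
      have hmany := acv_mismatch_many h B d hf hh hB hd p q σ τ xs hμ0
      set S := univ.filter (fun x₁ : Fin a → Bool =>
        (B x₁ p q && (h (fun j => (d x₁ j ^^ (B x₁ p j && B x₁ q j)) ^^ (σ && B x₁ p j) ^^ (τ && B x₁ q j)) ^^
          f (Fin.append x₁ zeroVec) ^^ (σ && τ))) = true) with hSdef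
      -- fibre sums: ≤ K on S, ≤ 2K elsewhere
      set Γ : (Fin a → Bool) → ℝ := fun x₁ => ∑ y ∈ univ.filter (fun y : Fin (a + 2) → Bool => φ y = x₁),
        signOf (h y) * W (fun x₂ => signOf (f (Fin.append x₁ x₂))) y with hΓdef
      have honS : ∀ x₁ ∈ S, Γ x₁ ≤ (2 : ℝ) ^ (a + 2) := by
        intro x₁ hx
        have hx' := (mem_filter.1 hx).2
        have hpq : B x₁ p q = true := by revert hx'; cases B x₁ p q <;> simp
        rw [hpq, Bool.true_and] at hx'
        have key := (ac_sum_four_signs (fun st : Bool × Bool =>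
          h (fun j => (d x₁ j ^^ (B x₁ p j && B x₁ q j)) ^^ (st.1 && B x₁ p j) ^^ (st.2 && B x₁ q j)) ^^
            f (Fin.append x₁ zeroVec) ^^ (st.1 && st.2))).2.1 (σ, τ) hx'
        show Γ x₁ ≤ _
        simp only [hΓdef]
        rw [hΓ x₁ p q hpq]
        have : (0 : ℝ) < (2 : ℝ) ^ (a + 2) / 2 := by positivity
        nlinarith
      have hoffS : ∀ x₁ ∈ univ.filter (fun x₁ : Fin a → Bool => ¬ (B x₁ p q && (h (fun j => (d x₁ j ^^ (B x₁ p j && B x₁ q j)) ^^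
          (σ && B x₁ p j) ^^ (τ && B x₁ q j)) ^^ f (Fin.append x₁ zeroVec) ^^ (σ && τ))) = true),
          Γ x₁ ≤ 2 * (2 : ℝ) ^ (a + 2) := by
        intro x₁ _
        have key := (ac_sum_four_signs (fun st : Bool × Bool =>
          h (fun j => (d x₁ j ^^ (B x₁ (P x₁) j && B x₁ (Q x₁) j)) ^^ (st.1 && B x₁ (P x₁) j) ^^ (st.2 && B x₁ (Q x₁) j)) ^^
            f (Fin.append x₁ zeroVec) ^^ (st.1 && st.2))).1
        show Γ x₁ ≤ _
        simp only [hΓdef]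
        rw [hΓ x₁ (P x₁) (Q x₁) (hPQ x₁)]
        have : (0 : ℝ) < (2 : ℝ) ^ (a + 2) / 2 := by positivity
        nlinarith
      have split : ∑ x₁ ∈ S, Γ x₁ + ∑ x₁ ∈ univ.filter (fun x₁ : Fin a → Bool => ¬ (B x₁ p q && (h (fun j =>
          (d x₁ j ^^ (B x₁ p j && B x₁ q j)) ^^ (σ && B x₁ p j) ^^ (τ && B x₁ q j)) ^^ f (Fin.append x₁ zeroVec) ^^ (σ && τ))) = true),
          Γ x₁ = ∑ x₁, Γ x₁ := sum_filter_add_sum_filter_not _ _ _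
      have hcS : ((univ.filter (fun x₁ : Fin a → Bool => ¬ (B x₁ p q && (h (fun j => (d x₁ j ^^ (B x₁ p j && B x₁ q j)) ^^
          (σ && B x₁ p j) ^^ (τ && B x₁ q j)) ^^ f (Fin.append x₁ zeroVec) ^^ (σ && τ))) = true)).card : ℝ) = (2 : ℝ) ^ a - S.card := by
        have e := Finset.card_filter_add_card_filter_not (s := (univ : Finset (Fin a → Bool)))
          (fun x₁ : Fin a → Bool => (B x₁ p q && (h (fun j => (d x₁ j ^^ (B x₁ p j && B x₁ q j)) ^^
            (σ && B x₁ p j) ^^ (τ && B x₁ q j)) ^^ f (Fin.append x₁ zeroVec) ^^ (σ && τ))) = true)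
        rw [card_univ, Fintype.card_fun, Fintype.card_bool, Fintype.card_fin] at e
        have e' := congrArg (Nat.cast : ℕ → ℝ) e
        push_cast at e'
        linarith
      have b1 : ∑ x₁ ∈ S, Γ x₁ ≤ S.card * (2 : ℝ) ^ (a + 2) := by
        have := sum_le_sum honS; rwa [sum_const, nsmul_eq_mul] at this
      have b2 := sum_le_sum hoffS
      rw [sum_const, nsmul_eq_mul, hcS] at b2
      have htotal : ∑ x₁, Γ x₁ ≤ 2 * (2 : ℝ) ^ (a + 2) * (2 : ℝ) ^ a - (2 : ℝ) ^ (a + 2) * S.card := by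
        rw [← split]; nlinarith
      have hSigma : ∑ x₁, Γ x₁ = (2 : ℝ) ^ (2 * a + 3) * forrelation f g := by rw [← hsumΦ, hdec]
      have hS : ((2 : ℕ) ^ a : ℝ) ≤ (2 : ℝ) ^ 7 * S.card := by exact_mod_cast hmany
      push_cast at hS
      -- 2^(2a+3) Φ ≤ 2^(2a+3) - 2^(a+2) * 2^a / 128 = 2^(2a+3) (1 - 1/256)
      have hK2 : (2 : ℝ) ^ (a + 2) * (2 : ℝ) ^ a = (2 : ℝ) ^ (2 * a + 3) / 2 := by
        rw [← pow_add]; ring_nf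
      nlinarith [pow_pos (show (0 : ℝ) < 2 by norm_num) (a + 2)]
    · -- no mismatch anywhere: every fibre sum is 2K and Φ = 1
      push Not at hmis
      left
      have hall : ∀ x₁, ∑ y ∈ univ.filter (fun y : Fin (a + 2) → Bool => φ y = x₁),
          signOf (h y) * W (fun x₂ => signOf (f (Fin.append x₁ x₂))) y = 2 * (2 : ℝ) ^ (a + 2) := by
        intro x₁
        rw [hΓ x₁ (P x₁) (Q x₁) (hPQ x₁)]
        have key := (ac_sum_four_signs (fun st : Bool × Bool =>
          h (fun j => (d x₁ j ^^ (B x₁ (P x₁) j && B x₁ (Q x₁) j)) ^^ (st.1 && B x₁ (P x₁) j) ^^ (st.2 && B x₁ (Q x₁) j)) ^^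
            f (Fin.append x₁ zeroVec) ^^ (st.1 && st.2))).2.2 (fun st => by
              have := hmis x₁ st
              revert this
              cases (h (fun j => (d x₁ j ^^ (B x₁ (P x₁) j && B x₁ (Q x₁) j)) ^^ (st.1 && B x₁ (P x₁) j) ^^ (st.2 && B x₁ (Q x₁) j)) ^^
                f (Fin.append x₁ zeroVec) ^^ (st.1 && st.2)) <;> simp)
        rw [key]; ring
      have hSigma : ∑ x₁ : Fin a → Bool, ∑ y ∈ univ.filter (fun y : Fin (a + 2) → Bool => φ y = x₁),
          signOf (h y) * W (fun x₂ => signOf (f (Fin.append x₁ x₂))) y = (2 : ℝ) ^ (2 * a + 3) := by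
        rw [sum_congr rfl fun x₁ _ => hall x₁, sum_const, card_univ, Fintype.card_fun, Fintype.card_bool,
          Fintype.card_fin, nsmul_eq_mul]
        push_cast
        rw [← e223]; ring
      rw [← hdec, hsumΦ] at hSigma
      have := mul_left_cancel₀ hpos.ne' (hSigma.trans (mul_one _).symm)
      exact this

end Summit.QuantumAdvantage.QuantumAdvantage.Theorems.CubicForrelation.NearExactIsExact

end
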